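import Summits.HubbardSuperconductivity.HubbardSuperconductivity.Theorems.BalabanIRBirGroundStateAverageLRO
import Summits.HubbardSuperconductivity.HubbardSuperconductivity.Theorems.BalabanIRBirEveryGroundStateAffine
import Summits.HubbardSuperconductivity.HubbardSuperconductivity.Theorems.BalabanIRBirEveryGroundStateUniqueGround
import Literature.MathematicalPhysics.QuantumLattice.GriffithsLemmaGroundStates

/-!
# Route `BalabanIR`, crux 5 `BirEveryGroundState` (`stmt-HubbardSuperconductivity-2083`):
# AVERAGE → EVERY is a theorem for the CONJUGATE observable (Griffiths' lemma)

Crux 5 asks: if the sector ground-state AVERAGE of `Δ_d† Δ_d` is large on a window of couplings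
`U`, is it large in EVERY sector ground state at some coupling of the window? This file records the
positive control that the item as typed lacks: the same implication is a THEOREM — at all but
countably many couplings, in particular at some coupling of every window — for any observable that
is CONJUGATE to the coupling being varied, because then all sector ground states at a non-exceptional
coupling share the expectation of that observable (Griffiths' lemma,
`Literature.MathematicalPhysics.QuantumLattice.GriffithsLemmaGroundStates`).

* `forall_ground_le_of_trace_le_of_ground_eq` — abstract core: if all normalised sector ground
  eigenvectors of `H` in `K` have the same `re ⟨·, Y ·⟩`, a ground-state-AVERAGE bound
  `a · re tr P ≤ re tr (P Y)` (`P` the projection onto the sector ground eigenspace, the shape of the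
  route's target) is a bound `a ≤ re ⟨ψ, Y ψ⟩` for EVERY normalised sector ground state `ψ`.
* `hubbardTorus_doublon_ground_eq_offCountable` — for the Hubbard tori
  `hubbardTorus 2 L 1 U = hubbardTorus 2 L 1 0 + U · D_L`, `D_L = Σ_x n_{x↑} n_{x↓}` the
  double occupancy (`UniqueGround.hubbardTorus_pencil`): off ONE countable set of couplings `U`, for
  every side `L` and every particle number `N`, all normalised `(N, S^z = 0)`-sector ground states
  share `re ⟨·, D_L ·⟩`.
* `hubbardTorus_doublon_every_of_average_offCountable` — hence off that countable set, at every
  `(L, N)` and for every threshold `a`, the AVERAGE bound `a · re tr P ≤ re tr (P D_L)` forces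
  `a ≤ re ⟨ψ, D_L ψ⟩` for EVERY normalised sector ground state `ψ`.
* `birEveryGroundState_analogue_doublon` (registered stub of the item) — **crux 5 with `Δ_d† Δ_d`
  replaced by the conjugate observable `D_L` is true**, in the crux's own quantifier shape and with
  arbitrary thresholds `a_L` (the crux has `a_L = c L⁴`; for `D_L` the meaningful scale is `L²`):
  a window-wide eventual AVERAGE bound yields a coupling of the window (indeed all but countably
  many) with the eventual EVERY-ground-state bound, same thresholds, same `L₀`. No positivity of
  `δ`, `U₁`, `c` is needed.
* `hubbardTorus_dWaveSource_ground_eq_offCountable`, `hubbardTorus_dWaveSource_every_of_average_offCountable`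
  — the same for the SOURCED family `κ ↦ hubbardTorus 2 L 1 U + κ · Δ_d† Δ_d` at fixed `U`: off a
  countable set of source strengths `κ` (every `L`, `N` at once) all sector ground states of the
  sourced Hamiltonian share `re ⟨·, Δ_d† Δ_d ·⟩`, so for the sourced model "average LRO = every LRO".
  Crux 5 is exactly the assertion that the one source strength the summit cares about, `κ = 0`, is
  non-exceptional in this sense at some `U` of every window, eventually in `L` — a source-less
  non-exceptionality statement about the Hubbard tori for which no mechanism is known (the
  conjugate-observable mechanism above is the only general one, and `Δ_d† Δ_d` is not conjugate to
  `U`); cf. the sourced re-cuts `…SourceShift`, `…ThermalChord` of the companion files, which move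
  the source into the hypothesis instead.

This module imports the route file (via `…BirGroundStateAverageLRO`, for the trace-average glue)
and is a `--supports` helper of the item; it closes nothing. Sources: R. B. Griffiths, Phys. Rev.
152 (1966) 240 §II–III; T. Kato, *Perturbation Theory for Linear Operators* (1966) II-§6.1;
H. Tasaki (2020) §2.1–2.2, §10.1. Folklore; no definition is introduced.
-/

noncomputable section

-- the mandated namespace `Summit.<Summit>.<Problem>.Theorems` repeats `HubbardSuperconductivity`
-- (single-problem summit, D-0017), which the `dupNamespace` linter flags on every declaration
set_option linter.dupNamespace false

namespace Summit.HubbardSuperconductivity.HubbardSuperconductivity.Theorems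

open Matrix Finset Filter
open Literature.Probability.LatticeModels Literature.MathematicalPhysics.QuantumLattice
open Summit.HubbardSuperconductivity.HubbardSuperconductivity.Theses.BalabanIR
open scoped ComplexOrder

/-! ### Abstract core: equal ground expectations turn an average bound into an every bound -/

section Abstract

variable {n : Type*} [Fintype n] [DecidableEq n]

/-- **Equal ground expectations + AVERAGE bound ⇒ EVERY bound.** For matrices `H`, `Y`, a sector
`K` and `e₀ = minEnergyOn H K`, suppose all normalised sector ground eigenvectors
(`ψ ∈ K`, `‖ψ‖ = 1`, `H ψ = e₀ ψ`) have the same `re ⟨ψ, Y ψ⟩`. If the ground-state AVERAGE bound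
`a · re tr P ≤ re tr (P Y)` holds, `P` the orthogonal projection onto the sector ground eigenspace
`K ⊓ ker (H - e₀)`, then `a ≤ re ⟨ψ, Y ψ⟩` for EVERY normalised sector ground eigenvector `ψ`
(pigeonhole over an orthonormal frame of the — then non-trivial — ground eigenspace,
`exists_unit_le_re_of_trace_projMatrix_map`, and the equality hypothesis). [folklore] -/
theorem forall_ground_le_of_trace_le_of_ground_eq (H Y : Matrix n n ℂ) (K : Submodule ℂ (n → ℂ))
    (a : ℝ)
    (heq : ∀ ψ φ : n → ℂ, ψ ∈ K → star ψ ⬝ᵥ ψ = 1 →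
      H *ᵥ ψ = ((H.minEnergyOn K : ℝ) : ℂ) • ψ → φ ∈ K → star φ ⬝ᵥ φ = 1 →
      H *ᵥ φ = ((H.minEnergyOn K : ℝ) : ℂ) • φ →
      (star ψ ⬝ᵥ Y *ᵥ ψ).re = (star φ ⬝ᵥ Y *ᵥ φ).re)
    (havg : a * (projMatrix ((K ⊓ Module.End.eigenspace (Matrix.toLin' H)
        ((H.minEnergyOn K : ℝ) : ℂ)).map ((WithLp.linearEquiv 2 ℂ (n → ℂ)).symm :
          (n → ℂ) →ₗ[ℂ] EuclideanSpace ℂ n))).trace.re ≤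
      (projMatrix ((K ⊓ Module.End.eigenspace (Matrix.toLin' H)
        ((H.minEnergyOn K : ℝ) : ℂ)).map ((WithLp.linearEquiv 2 ℂ (n → ℂ)).symm :
          (n → ℂ) →ₗ[ℂ] EuclideanSpace ℂ n)) * Y).trace.re) :
    ∀ ψ : n → ℂ, ψ ∈ K → star ψ ⬝ᵥ ψ = 1 → H *ᵥ ψ = ((H.minEnergyOn K : ℝ) : ℂ) • ψ →
      a ≤ (star ψ ⬝ᵥ Y *ᵥ ψ).re := by
  intro ψ hψK hψ1 hψeig
  set E₀ : Submodule ℂ (n → ℂ) :=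
    K ⊓ Module.End.eigenspace (Matrix.toLin' H) ((H.minEnergyOn K : ℝ) : ℂ)
  have hψE : ψ ∈ E₀ := by
    refine Submodule.mem_inf.mpr ⟨hψK, ?_⟩
    rw [Module.End.mem_eigenspace_iff, Matrix.toLin'_apply]
    exact hψeig
  have hψ0 : ψ ≠ 0 := by
    rintro rfl
    simp at hψ1
  have hne : E₀ ≠ ⊥ := (Submodule.ne_bot_iff E₀).mpr ⟨ψ, hψE, hψ0⟩
  obtain ⟨φ, hφE, hφ1, hφle⟩ := exists_unit_le_re_of_trace_projMatrix_map E₀ hne Y a havg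
  obtain ⟨hφK, hφeig⟩ := Submodule.mem_inf.mp hφE
  rw [Module.End.mem_eigenspace_iff, Matrix.toLin'_apply] at hφeig
  rw [heq ψ φ hψK hψ1 hψeig hφK hφ1 hφeig]
  exact hφle

end Abstract

/-! ### The Hubbard tori: the double occupancy is conjugate to `U` -/

section Hubbard

/-- **Griffiths' lemma for the Hubbard tori (double occupancy).** There is ONE countable set `X` of
couplings such that for every `U ∉ X`, every side `L`, every particle number `N` and any two
normalised `(N, S^z = 0)`-sector ground states `ψ`, `φ` of `hubbardTorus 2 L 1 U`:
`re ⟨ψ, D_L ψ⟩ = re ⟨φ, D_L φ⟩`, `D_L = Σ_x n_{x↑} n_{x↓}` — all sector ground states at a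
non-exceptional coupling have the same double occupancy. (The countable family of Hermitian pencils
`hubbardTorus 2 L 1 0 + U · D_L` on the sectors `szSector N 0`, indexed by `(L, N)`:
`countable_setOf_exists_not_forall_ground_re_rayleigh_eq`.) Griffiths, Phys. Rev. 152 (1966) 240
§III; Kato (1966) II-§6.1. [folklore] -/
theorem hubbardTorus_doublon_ground_eq_offCountable :
    ∃ X : Set ℝ, X.Countable ∧ ∀ U : ℝ, U ∉ X →
      ∀ (L N : ℕ) (ψ φ : Fock (Orb (FermionTorus 2 L))),
        IsGroundStateInSector (hubbardTorus 2 L 1 U) N 0 ψ → star ψ ⬝ᵥ ψ = 1 →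
        IsGroundStateInSector (hubbardTorus 2 L 1 U) N 0 φ → star φ ⬝ᵥ φ = 1 →
        (star ψ ⬝ᵥ (∑ x : FermionTorus 2 L, numberOp x 0 * numberOp x 1) *ᵥ ψ).re =
          (star φ ⬝ᵥ (∑ x : FermionTorus 2 L, numberOp x 0 * numberOp x 1) *ᵥ φ).re := by
  have hX := countable_setOf_exists_not_forall_ground_re_rayleigh_eq (ι := ℕ × ℕ)
    (m := fun p => Finset (Orb (FermionTorus 2 p.1)))
    (fun p => hubbardTorus 2 p.1 1 0)
    (fun p => (∑ x : FermionTorus 2 p.1, numberOp x 0 * numberOp x 1 :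
      Matrix (Finset (Orb (FermionTorus 2 p.1))) (Finset (Orb (FermionTorus 2 p.1))) ℂ))
    (fun p => LiebThm1.hamiltonian_isHermitian (fermionTorusGraph 2 p.1) 1 0)
    (fun p => doublon_isHermitian)
    (fun p => szSector (Λ := FermionTorus 2 p.1) p.2 0)
  refine ⟨_, hX, fun U hU L N ψ φ hψ hψ1 hφ hφ1 => ?_⟩
  simp only [Set.mem_setOf_eq, not_exists, not_not] at hU
  obtain ⟨hψS, -, hψeig⟩ := hψ
  obtain ⟨hφS, -, hφeig⟩ := hφ
  rw [UniqueGround.hubbardTorus_pencil L U] at hψeig hφeig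
  exact hU (L, N) ψ φ hψS hψ1 (re_rayleigh_of_eigen_minEnergyOn _ _ hψ1 hψeig) hφS hφ1
    (re_rayleigh_of_eigen_minEnergyOn _ _ hφ1 hφeig)

/-- **Off a countable set of couplings, an AVERAGE bound on the double occupancy is an EVERY
bound.** With the countable exceptional set `X` of `hubbardTorus_doublon_ground_eq_offCountable`:
for `U ∉ X`, every `L`, `N` and threshold `a`, if `a · re tr P ≤ re tr (P D_L)` with `P` the
projection onto the `(N, S^z = 0)`-sector ground eigenspace of `hubbardTorus 2 L 1 U` (the
basis-free ground-state average, as in the route's target), then `a ≤ re ⟨ψ, D_L ψ⟩` for EVERY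
normalised sector ground state `ψ`. Griffiths, Phys. Rev. 152 (1966) 240 §III. [folklore] -/
theorem hubbardTorus_doublon_every_of_average_offCountable :
    ∃ X : Set ℝ, X.Countable ∧ ∀ U : ℝ, U ∉ X → ∀ (L N : ℕ) (a : ℝ),
      let H := hubbardTorus 2 L 1 U
      let S := szSector (Λ := FermionTorus 2 L) N 0
      let E₀ := S ⊓ Module.End.eigenspace (Matrix.toLin' H) ((H.minEnergyOn S : ℝ) : ℂ)
      let P := projMatrix (E₀.map (Fock.toEuclidean (ι := Orb (FermionTorus 2 L)) :
        Fock (Orb (FermionTorus 2 L)) →ₗ[ℂ] EuclideanSpace ℂ (Finset (Orb (FermionTorus 2 L)))))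
      a * P.trace.re ≤ (P * (∑ x : FermionTorus 2 L, numberOp x 0 * numberOp x 1)).trace.re →
      ∀ ψ : Fock (Orb (FermionTorus 2 L)), IsGroundStateInSector H N 0 ψ → star ψ ⬝ᵥ ψ = 1 →
        a ≤ (star ψ ⬝ᵥ (∑ x : FermionTorus 2 L, numberOp x 0 * numberOp x 1) *ᵥ ψ).re := by
  obtain ⟨X, hX, hU⟩ := hubbardTorus_doublon_ground_eq_offCountable
  refine ⟨X, hX, fun U hUX L N a => ?_⟩
  intro H S E₀ P havg ψ hψ hψ1
  have heq : ∀ ψ φ : Fock (Orb (FermionTorus 2 L)), ψ ∈ S → star ψ ⬝ᵥ ψ = 1 →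
      H *ᵥ ψ = ((H.minEnergyOn S : ℝ) : ℂ) • ψ → φ ∈ S → star φ ⬝ᵥ φ = 1 →
      H *ᵥ φ = ((H.minEnergyOn S : ℝ) : ℂ) • φ →
      (star ψ ⬝ᵥ (∑ x : FermionTorus 2 L, numberOp x 0 * numberOp x 1) *ᵥ ψ).re =
        (star φ ⬝ᵥ (∑ x : FermionTorus 2 L, numberOp x 0 * numberOp x 1) *ᵥ φ).re := by
    intro ψ φ hψS hψ1 hψeig hφS hφ1 hφeig
    exact hU U hUX L N ψ φ ⟨hψS, fun h => by simp [h] at hψ1, hψeig⟩ hψ1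
      ⟨hφS, fun h => by simp [h] at hφ1, hφeig⟩ hφ1
  exact forall_ground_le_of_trace_le_of_ground_eq H _ S a heq havg ψ hψ.1 hψ1 hψ.2.2

/-- **Crux 5 holds for the conjugate observable** (registered stub of `stmt-HubbardSuperconductivity-2083`).
Replace, in `BirEveryGroundState`, the pair observable `Δ_d† Δ_d` by the double occupancy
`D_L = Σ_x n_{x↑} n_{x↓} = ∂_U hubbardTorus 2 L 1 U` and the thresholds `c L⁴` by arbitrary
`a_L`: if on a window `(U₁, U₂)` the `(2⌊(1-δ)L²/2⌋, S^z = 0)`-sector ground-state AVERAGE of `D_L`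
is eventually (even `L ≥ L₀(U)`) at least `a_L` at every coupling, then at SOME coupling `U` of the
window (in fact at all but countably many) EVERY normalised sector ground state `ψ` has
`a_L ≤ re ⟨ψ, D_L ψ⟩` eventually, with the same `L₀(U)`. Proof: pick `U` in the window off the
countable exceptional set of `hubbardTorus_doublon_every_of_average_offCountable` (a countable set
has dense complement in `ℝ`). This is the AVERAGE → EVERY transfer the item wants, valid because
`D_L` is conjugate to `U`; no such mechanism exists for `Δ_d† Δ_d` at source strength `0`
(`hubbardTorus_dWaveSource_ground_eq_offCountable` gives it only off a countable set of source
strengths). Griffiths, Phys. Rev. 152 (1966) 240 §II–III. [folklore] -/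
theorem birEveryGroundState_analogue_doublon : ∀ (a : ℕ → ℝ) (δ U₁ U₂ : ℝ), U₁ < U₂ → (∀ U ∈ Set.Ioo U₁ U₂, ∃ L₀ : ℕ, ∀ (L : ℕ) [NeZero L], L₀ ≤ L → Even L → let N : ℕ := 2 * ⌊(1 - δ) * (L : ℝ) ^ 2 / 2⌋₊; let H := hubbardTorus 2 L 1 U; let S := szSector (Λ := FermionTorus 2 L) N 0; let E₀ := S ⊓ Module.End.eigenspace (Matrix.toLin' H) ((H.minEnergyOn S : ℝ) : ℂ); let P := projMatrix (E₀.map (Fock.toEuclidean (ι := Orb (FermionTorus 2 L)) : Fock (Orb (FermionTorus 2 L)) →ₗ[ℂ] EuclideanSpace ℂ (Finset (Orb (FermionTorus 2 L))))); a L * P.trace.re ≤ (P * (∑ x : FermionTorus 2 L, numberOp x 0 * numberOp x 1)).trace.re) → ∃ U ∈ Set.Ioo U₁ U₂, ∃ L₀ : ℕ, ∀ (L : ℕ) [NeZero L], L₀ ≤ L → Even L → ∀ ψ : Fock (Orb (FermionTorus 2 L)), IsGroundStateInSector (hubbardTorus 2 L 1 U) (2 * ⌊(1 - δ) * (L : ℝ)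 ^ 2 / 2⌋₊) 0 ψ → star ψ ⬝ᵥ ψ = 1 → a L ≤ (star ψ ⬝ᵥ (∑ x : FermionTorus 2 L, numberOp x 0 * numberOp x 1) *ᵥ ψ).re := by
  intro a δ U₁ U₂ hU₁₂ havg
  obtain ⟨X, hX, hgood⟩ := hubbardTorus_doublon_every_of_average_offCountable
  obtain ⟨U, hUX, hU⟩ :=
    (Set.Countable.dense_compl ℝ hX).exists_mem_open isOpen_Ioo (Set.nonempty_Ioo.mpr hU₁₂)
  obtain ⟨L₀, hL₀⟩ := havg U hU
  refine ⟨U, hU, L₀, fun L _ hL hLe ψ hψ hψ1 => ?_⟩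
  exact hgood U hUX L _ (a L) (hL₀ L hL hLe) ψ hψ hψ1

/-- **All but countably many couplings of the window work.** The window form of
`hubbardTorus_doublon_every_of_average_offCountable` with the exceptional set displayed: under the
window-average hypothesis of `birEveryGroundState_analogue_doublon`, the EVERY-ground-state
conclusion holds at every coupling of the window outside one countable set (not only at one).
Griffiths, Phys. Rev. 152 (1966) 240 §III. [folklore] -/
theorem birEveryGroundState_analogue_doublon_offCountable :
    ∃ X : Set ℝ, X.Countable ∧ ∀ (a : ℕ → ℝ) (δ : ℝ) (U : ℝ), U ∉ X →
      (∃ L₀ : ℕ, ∀ (L : ℕ) [NeZero L], L₀ ≤ L → Even L →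
        let N : ℕ := 2 * ⌊(1 - δ) * (L : ℝ) ^ 2 / 2⌋₊
        let H := hubbardTorus 2 L 1 U
        let S := szSector (Λ := FermionTorus 2 L) N 0
        let E₀ := S ⊓ Module.End.eigenspace (Matrix.toLin' H) ((H.minEnergyOn S : ℝ) : ℂ)
        let P := projMatrix (E₀.map (Fock.toEuclidean (ι := Orb (FermionTorus 2 L)) :
          Fock (Orb (FermionTorus 2 L)) →ₗ[ℂ] EuclideanSpace ℂ (Finset (Orb (FermionTorus 2 L)))))
        a L * P.trace.re ≤ (P * (∑ x : FermionTorus 2 L, numberOp x 0 * numberOp x 1)).trace.re) →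
      ∃ L₀ : ℕ, ∀ (L : ℕ) [NeZero L], L₀ ≤ L → Even L →
        ∀ ψ : Fock (Orb (FermionTorus 2 L)),
          IsGroundStateInSector (hubbardTorus 2 L 1 U) (2 * ⌊(1 - δ) * (L : ℝ) ^ 2 / 2⌋₊) 0 ψ →
          star ψ ⬝ᵥ ψ = 1 →
          a L ≤ (star ψ ⬝ᵥ (∑ x : FermionTorus 2 L, numberOp x 0 * numberOp x 1) *ᵥ ψ).re := by
  obtain ⟨X, hX, hgood⟩ := hubbardTorus_doublon_every_of_average_offCountable
  refine ⟨X, hX, fun a δ U hUX havg => ?_⟩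
  obtain ⟨L₀, hL₀⟩ := havg
  exact ⟨L₀, fun L _ hL hLe ψ hψ hψ1 => hgood U hUX L _ (a L) (hL₀ L hL hLe) ψ hψ hψ1⟩

/-! ### The sourced d-wave family: average = every off a countable set of source strengths -/

/-- **Griffiths' lemma for the sourced pair Hamiltonians.** Fix a coupling `U`. There is a
countable set `X` of source strengths such that for every `κ ∉ X`, every `L ≥ 1`, `N` and any two
normalised `(N, S^z = 0)`-sector ground states `ψ`, `φ` of the SOURCED Hamiltonian
`hubbardTorus 2 L 1 U + κ · Δ_d† Δ_d` (`Δ_d = pairField dWaveFormFactor L`):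
`re ⟨ψ, Δ_d† Δ_d ψ⟩ = re ⟨φ, Δ_d† Δ_d φ⟩`. (The pencils `κ ↦ H_U + κ Δ_d† Δ_d` on `szSector N 0`,
indexed by `(L, N)`.) Crux 5 is the assertion that `κ = 0` has this property (up to the weaker
"bottom ≥ c' L⁴ given average ≥ c L⁴") at some `U` of every window, eventually in even `L`; the
lemma gives it only off an unspecified countable set of `κ`. Griffiths, Phys. Rev. 152 (1966) 240
§III; Koma–Tasaki, J. Stat. Phys. 76 (1994) 745 §1. [folklore] -/
theorem hubbardTorus_dWaveSource_ground_eq_offCountable (U : ℝ) :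
    ∃ X : Set ℝ, X.Countable ∧ ∀ κ : ℝ, κ ∉ X →
      ∀ (L : ℕ) [NeZero L] (N : ℕ) (ψ φ : Fock (Orb (FermionTorus 2 L))),
        IsGroundStateInSector (hubbardTorus 2 L 1 U +
          (κ : ℂ) • ((pairField dWaveFormFactor L)ᴴ * pairField dWaveFormFactor L)) N 0 ψ →
        star ψ ⬝ᵥ ψ = 1 →
        IsGroundStateInSector (hubbardTorus 2 L 1 U +
          (κ : ℂ) • ((pairField dWaveFormFactor L)ᴴ * pairField dWaveFormFactor L)) N 0 φ →
        star φ ⬝ᵥ φ = 1 →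
        (star ψ ⬝ᵥ ((pairField dWaveFormFactor L)ᴴ * pairField dWaveFormFactor L) *ᵥ ψ).re =
          (star φ ⬝ᵥ ((pairField dWaveFormFactor L)ᴴ * pairField dWaveFormFactor L) *ᵥ φ).re := by
  -- index the sides as `k + 1` so that the instance `NeZero (k + 1)` is available to `pairField`
  have hX := countable_setOf_exists_not_forall_ground_re_rayleigh_eq (ι := ℕ × ℕ)
    (m := fun p => Finset (Orb (FermionTorus 2 (p.1 + 1))))
    (fun p => hubbardTorus 2 (p.1 + 1) 1 U)
    (fun p => ((pairField dWaveFormFactor (p.1 + 1))ᴴ * pairField dWaveFormFactor (p.1 + 1) :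
      Matrix (Finset (Orb (FermionTorus 2 (p.1 + 1)))) (Finset (Orb (FermionTorus 2 (p.1 + 1)))) ℂ))
    (fun p => LiebThm1.hamiltonian_isHermitian (fermionTorusGraph 2 (p.1 + 1)) 1 U)
    (fun p => isHermitian_conjTranspose_mul_self _)
    (fun p => szSector (Λ := FermionTorus 2 (p.1 + 1)) p.2 0)
  refine ⟨_, hX, fun κ hκ L _ N ψ φ hψ hψ1 hφ hφ1 => ?_⟩
  simp only [Set.mem_setOf_eq, not_exists, not_not] at hκ
  obtain ⟨k, rfl⟩ := Nat.exists_eq_succ_of_ne_zero (NeZero.ne L)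
  obtain ⟨hψS, -, hψeig⟩ := hψ
  obtain ⟨hφS, -, hφeig⟩ := hφ
  exact hκ (k, N) ψ φ hψS hψ1 (re_rayleigh_of_eigen_minEnergyOn _ _ hψ1 hψeig) hφS hφ1
    (re_rayleigh_of_eigen_minEnergyOn _ _ hφ1 hφeig)

/-- **For the sourced model, average LRO = every LRO off a countable set of source strengths.**
Fix `U`. With the countable set `X` of `hubbardTorus_dWaveSource_ground_eq_offCountable`: for
`κ ∉ X`, every `L ≥ 1`, `N` and threshold `a`, if `a · re tr P_κ ≤ re tr (P_κ Δ_d† Δ_d)` with `P_κ` the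
projection onto the `(N, S^z = 0)`-sector ground eigenspace of `hubbardTorus 2 L 1 U + κ Δ_d† Δ_d`,
then `a ≤ re ⟨ψ, Δ_d† Δ_d ψ⟩` for EVERY normalised sector ground state `ψ` of that sourced
Hamiltonian. (For `κ > 0` the companion `…SourceShift` even bounds every UNSOURCED ground state;
what no argument supplies is the case `κ = 0` on both sides, i.e. crux 5.) Griffiths, Phys. Rev.
152 (1966) 240 §III. [folklore] -/
theorem hubbardTorus_dWaveSource_every_of_average_offCountable (U : ℝ) :
    ∃ X : Set ℝ, X.Countable ∧ ∀ κ : ℝ, κ ∉ X → ∀ (L : ℕ) [NeZero L] (N : ℕ) (a : ℝ),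
      let H := hubbardTorus 2 L 1 U +
        (κ : ℂ) • ((pairField dWaveFormFactor L)ᴴ * pairField dWaveFormFactor L)
      let S := szSector (Λ := FermionTorus 2 L) N 0
      let E₀ := S ⊓ Module.End.eigenspace (Matrix.toLin' H) ((H.minEnergyOn S : ℝ) : ℂ)
      let P := projMatrix (E₀.map (Fock.toEuclidean (ι := Orb (FermionTorus 2 L)) :
        Fock (Orb (FermionTorus 2 L)) →ₗ[ℂ] EuclideanSpace ℂ (Finset (Orb (FermionTorus 2 L)))))
      a * P.trace.re ≤
          (P * ((pairField dWaveFormFactor L)ᴴ * pairField dWaveFormFactor L)).trace.re →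
      ∀ ψ : Fock (Orb (FermionTorus 2 L)), IsGroundStateInSector H N 0 ψ → star ψ ⬝ᵥ ψ = 1 →
        a ≤ (star ψ ⬝ᵥ ((pairField dWaveFormFactor L)ᴴ * pairField dWaveFormFactor L) *ᵥ ψ).re := by
  obtain ⟨X, hX, hκ⟩ := hubbardTorus_dWaveSource_ground_eq_offCountable U
  refine ⟨X, hX, fun κ hκX L _ N a => ?_⟩
  intro H S E₀ P havg ψ hψ hψ1
  have heq : ∀ ψ φ : Fock (Orb (FermionTorus 2 L)), ψ ∈ S → star ψ ⬝ᵥ ψ = 1 →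
      H *ᵥ ψ = ((H.minEnergyOn S : ℝ) : ℂ) • ψ → φ ∈ S → star φ ⬝ᵥ φ = 1 →
      H *ᵥ φ = ((H.minEnergyOn S : ℝ) : ℂ) • φ →
      (star ψ ⬝ᵥ ((pairField dWaveFormFactor L)ᴴ * pairField dWaveFormFactor L) *ᵥ ψ).re =
        (star φ ⬝ᵥ ((pairField dWaveFormFactor L)ᴴ * pairField dWaveFormFactor L) *ᵥ φ).re := by
    intro ψ φ hψS hψ1 hψeig hφS hφ1 hφeig
    exact hκ κ hκX L N ψ φ ⟨hψS, fun h => by simp [h] at hψ1, hψeig⟩ hψ1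
      ⟨hφS, fun h => by simp [h] at hφ1, hφeig⟩ hφ1
  exact forall_ground_le_of_trace_le_of_ground_eq H _ S a heq havg ψ hψ.1 hψ1 hψ.2.2

end Hubbard

end Summit.HubbardSuperconductivity.HubbardSuperconductivity.Theorems
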